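import Literature.NumberTheory.EllipticCurves.NeronComponentIndexTypeIVProofs
import Literature.NumberTheory.EllipticCurves.TamagawaVariableChangeProofs
import HarnessLib

/-!
# The local index for type `IV` over a Henselian ring: `c = 3` iff the Step-5 quadratic has a root (proof)

Sequel of `NeronComponentIndexTypeIVProofs.lean`, which discharges the named fact
`localTamagawaNumber_of_kodairaSymbolAt_eq_IV` in the recorded WEAK form `c_v ∈ {1, 3}`
(`NeronComponentIndex.lean`: "where the printed value depends on the rationality over `k` of the
roots of an auxiliary polynomial (Steps 5–8), the fact records the disjunction of the printed
alternatives … the exact alternative would refer to the normalising translations chosen inside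
the algorithm"). This file proves the **printed exact alternative** of Silverman, *ATAEC*,
IV.9.4 Step 5 (PDF p. 344): "Type IV, `m = 3`, `f = v(Δ) − 2`, and `c = 3` if `k' = k`, `c = 1`
if `k' ≠ k`", `k'` the splitting field over `k` of `T² + a₃,₁T − a₆,₂` — stated, as in the
source, RELATIVE TO A NORMAL FORM: for an equation `J` over a discrete valuation ring `R` with
`a₁, a₂, a₃ ∈ 𝔪`, `a₄, a₆ ∈ 𝔪²` and `a₃ = ϖγ`, `a₆ = ϖ²ε` with `γ̄² + 4ε̄ ≠ 0` (the normal form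
reached after Steps 2–4, tree `exists_smul_of_kodairaSymbolOfMinimal_eq_IV`), the index
`[E(K) : E₀(K)]` is `3` iff `Y² + γ̄Y − ε̄` has a root in `k`, and `1` otherwise — PROVIDED `R`
is Henselian (the printed setting is a complete field, *ATAEC* IV.9 p. 339 and Rem. IV.9.3,
PDF p. 341: over a complete or Henselian `K` the group of components of the Néron model IS
`E(K)/E₀(K)`). Over a non-Henselian `R` only `c ∈ {1, 3}` and the implication
"`c = 3 ⇒` root" survive (both Hensel-free, already in the tree's proof).

## Proof

* (⇐, Hensel) Lift a root `r` of the separable quadratic `Y² + γ̄Y − ε̄` to `y₁ ∈ R` with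
  `y₁² + γy₁ − ε = 0` (`HenselianLocalRing.is_henselian` on the monic `Y² + γY − ε`; the root is
  simple because `(2r + γ̄)² = γ̄² + 4ε̄ ≠ 0`, tree `two_mul_add_ne_zero_of_root`). Then
  `P₀ = (0, ϖy₁)` lies on `J` (the equation at `x = 0` reads `ϖ²(y₁² + γy₁ − ε) = 0`) and is a
  bad point (both coordinates in `𝔪`, tree `not_hasNonsingularReduction_some`), so the index is
  not `1`, hence `3` by the tree's `index_mem_of_normalForm_IV` (Silverman's proof, PDF
  pp. 348–349: the bad points fall into two classes swapped by negation; Fig. 4.4).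
* (⇒, no Hensel) A bad point is `(ϖx₁, ϖy₁)` with `ȳ₁` a root (tree
  `exists_eq_some_of_not_hasNonsingularReduction_IV`).
* For an elliptic curve `W` over the fraction field `K` of a Henselian `R` and ANY `R`-integral
  MINIMAL model `J` of `W` in the normal form, `c(W/K) = [J(K) : J₀(K)]` (tree
  `index_goodReductionSubgroup_eq_of_eq_smul`, `goodReductionSubgroup_baseChange_eq`,
  `localTamagawaNumber_variableChange_holds`), whence the exact value of the local Tamagawa
  number (`localTamagawaNumber_eq_three_iff_exists_root_of_normalForm_IV`).

Motivation: BSD rank-`≤ 1` residual cell `b2b-bsdres`, team n1011, row T-MIL-B (stage B of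
T-MIL-ODD: the `p = 3` entries of the odd part of Milne's quadratic BSD-quotient identity need
the EXACT `c ∈ {1, 3}` alternative at places of type `IV`/`IV*` and its behaviour under
unramified / ramified quadratic base change and unit twists — sequel files).

## References

* J. H. Silverman, *Advanced Topics in the Arithmetic of Elliptic Curves*, GTM 151, Springer
  1994, IV.9 (setting, PDF p. 339), Rem. IV.9.3 (PDF p. 341), IV.9.4 Step 5 (PDF p. 344) and
  its proof (PDF pp. 348–349, Fig. 4.4). [SilvermanATAEC1994]
* J. Tate, *Algorithm for determining the type of a singular fiber in an elliptic pencil*,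
  LNM 476 (1975), §7 case 5). [Tate1975]

## Design

Theorems only; no definition (the normal form is carried by its divisibility binders, exactly
as in the tree's `index_mem_of_normalForm_IV`), no named fact, no `sorry`. The uniformiser `ϖ`
is ANY irreducible element (not necessarily `uniformizer R`), so that the sequel files can read
one normal form along a ramified extension. `[HenselianLocalRing R]` appears only where Hensel
is used.
-/

noncomputable section

open scoped Classical

open IsLocalRing Polynomial

namespace Literature.NumberTheory.EllipticCurves

namespace LocalIndex

open DiophantineGeometry DiophantineGeometry.TateAlgorithm

variable {R : Type*} [CommRing R] [IsDomain R] [IsDiscreteValuationRing R]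

/-! ### Hensel: a residual root of the Step-5 quadratic lifts -/

/-- **Hensel for the Step-5 quadratic.** Over a Henselian local ring, a root `r ∈ k` of the
SEPARABLE quadratic `Y² + γ̄Y − ε̄` (`γ̄² + 4ε̄ ≠ 0`) lifts to `y ∈ R` with `y² + γy − ε = 0` and
`ȳ = r` (the root is simple: `(2r + γ̄)² = γ̄² + 4ε̄`). [cite: SilvermanATAEC1994, IV.9.4 Step 5 (PDF p. 344) with Rem. IV.9.3 (PDF p. 341)] -/
theorem exists_root_of_residue_root_quadratic {S : Type*} [CommRing S] [HenselianLocalRing S]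
    {γ ε : S} {r : ResidueField S} (hr : r ^ 2 + residue S γ * r - residue S ε = 0)
    (hdisc : residue S γ ^ 2 + 4 * residue S ε ≠ 0) :
    ∃ y : S, y ^ 2 + γ * y - ε = 0 ∧ residue S y = r := by
  obtain ⟨y₀, hy₀⟩ := residue_surjective r
  set g : S[X] := X ^ 2 + C γ * X - C ε with hg
  have hmonic : g.Monic := by
    rw [hg]
    refine Monic.sub_of_left (Monic.add_of_left (monic_X_pow 2) ?_) ?_
    · exact (degree_C_mul_X_le γ).trans_lt (by rw [degree_X_pow]; norm_num)
    · exact (degree_C_le).trans_lt (by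
        rw [degree_add_eq_left_of_degree_lt] <;> rw [degree_X_pow]
        · norm_num
        · exact (degree_C_mul_X_le γ).trans_lt (by norm_num))
  have hev : ∀ t, g.eval t = t ^ 2 + γ * t - ε := by
    intro t; simp [hg]
  have hev' : ∀ t, g.derivative.eval t = 2 * t + γ := by
    intro t
    simp [hg]
    ring
  have h₁ : g.eval y₀ ∈ maximalIdeal S := by
    rw [hev, ← residue_eq_zero_iff, map_sub, map_add, map_pow, map_mul, hy₀, hr]
  have h₂ : IsUnit (g.derivative.eval y₀) := by
    rw [hev', ← residue_ne_zero_iff_isUnit, map_add, map_mul, map_ofNat, hy₀]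
    exact two_mul_add_ne_zero_of_root hr hdisc
  obtain ⟨y, hy, hyy₀⟩ := HenselianLocalRing.is_henselian g hmonic y₀ h₁ h₂
  refine ⟨y, by rw [← hev]; exact hy, ?_⟩
  rw [← hy₀, ← sub_eq_zero, ← map_sub, residue_eq_zero_iff]
  exact hyy₀

variable {K : Type*} [Field K] [Algebra R K] [IsFractionRing R K]

/-! ### The bad point `(0, ϖ y₁)` -/

/-- **A residual root gives a bad point** (type `IV` normal form, Henselian `R`). If `a₃ = ϖγ`,
`a₄ ∈ 𝔪`, `a₆ = ϖ²ε`, `Δ ≠ 0`, `γ̄² + 4ε̄ ≠ 0` and `r` is a root of `Y² + γ̄Y − ε̄` in `k`, then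
for a Hensel lift `y₁` of `r` with `y₁² + γy₁ = ε` the point `P₀ = (0, ϖy₁)` lies on `J`
(at `x = 0` the equation is `ϖ²(y₁² + γy₁ − ε) = 0`) and does NOT have nonsingular reduction
(it reduces to the singular point `(0, 0)`). This is the component of `ȳ₁ = r` of Silverman's
Fig. 4.4. [cite: SilvermanATAEC1994, IV.9.4 Step 5 (PDF p. 344; proof pp. 348–349)] -/
theorem exists_not_hasNonsingularReduction_of_root_IV [HenselianLocalRing R]
    (J : WeierstrassCurve R) {ϖ γ ε : R} (hϖ : Irreducible ϖ) (hγ : J.a₃ = ϖ * γ)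
    (h4 : J.a₄ ∈ maximalIdeal R) (hε : J.a₆ = ϖ ^ 2 * ε)
    (hdisc : residue R γ ^ 2 + 4 * residue R ε ≠ 0) (hΔ : J.Δ ≠ 0) {r : ResidueField R}
    (hr : r ^ 2 + residue R γ * r - residue R ε = 0) :
    ∃ (y₁ : R) (h : (J.baseChange K).toAffine.Nonsingular (algebraMap R K 0)
      (algebraMap R K (ϖ * y₁))),
      residue R y₁ = r ∧ ¬ J.HasNonsingularReduction (.some _ _ h) := by
  obtain ⟨y₁, hy₁, hres⟩ := exists_root_of_residue_root_quadratic hr hdisc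
  have hm : ϖ ∈ maximalIdeal R := (IsLocalRing.mem_maximalIdeal _).mpr hϖ.not_isUnit
  have h3 : J.a₃ ∈ maximalIdeal R := hγ ▸ Ideal.mul_mem_right _ _ hm
  -- the equation at `(0, ϖ y₁)`
  have heqR : J.toAffine.Equation 0 (ϖ * y₁) := by
    rw [WeierstrassCurve.Affine.equation_iff, hγ, hε]
    linear_combination ϖ ^ 2 * hy₁
  have heq : (J.baseChange K).toAffine.Equation (algebraMap R K 0) (algebraMap R K (ϖ * y₁)) :=
    (WeierstrassCurve.Affine.map_equation _ (IsFractionRing.injective R K) _ _).mpr heqR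
  have hΔK : (J.baseChange K).Δ ≠ 0 := by
    simpa only [WeierstrassCurve.baseChange, WeierstrassCurve.map_Δ,
      map_ne_zero_iff _ (IsFractionRing.injective R K)] using hΔ
  have h : (J.baseChange K).toAffine.Nonsingular (algebraMap R K 0) (algebraMap R K (ϖ * y₁)) :=
    ((J.baseChange K).toAffine.equation_iff_nonsingular_of_Δ_ne_zero hΔK).mp heq
  exact ⟨y₁, h, hres, not_hasNonsingularReduction_some J h3 h4 (zero_mem _)
    (Ideal.mul_mem_right _ _ hm) h⟩

/-! ### The exact index for the normal form -/

/-- `b₆ ∉ 𝔪³` for the normal form: with `a₃ = ϖγ`, `a₆ = ϖ²ε` one has `b₆ = ϖ²(γ² + 4ε)`,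
and `γ̄² + 4ε̄ ≠ 0` says `γ² + 4ε` is a unit (private helper). [folklore] -/
private theorem b₆_not_mem_pow_three_of_disc_ne_zero (J : WeierstrassCurve R) {ϖ γ ε : R}
    (hϖ : Irreducible ϖ) (hγ : J.a₃ = ϖ * γ) (hε : J.a₆ = ϖ ^ 2 * ε)
    (hdisc : residue R γ ^ 2 + 4 * residue R ε ≠ 0) : J.b₆ ∉ maximalIdeal R ^ 3 := by
  intro hb
  have hb₆ : J.b₆ = ϖ ^ 2 * (γ ^ 2 + 4 * ε) := by
    rw [WeierstrassCurve.b₆, hγ, hε]; ring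
  rw [hϖ.maximalIdeal_eq, Ideal.span_singleton_pow, Ideal.mem_span_singleton, hb₆,
    pow_succ, mul_dvd_mul_iff_left (pow_ne_zero 2 hϖ.ne_zero)] at hb
  apply hdisc
  have := residue_eq_zero_of_dvd hϖ hb
  simpa only [map_add, map_pow, map_mul, map_ofNat] using this

/-- **`c = 3 ⇒` the Step-5 quadratic has a root** (no Hensel needed): if the index of `E₀(K)`
is not `1`, a bad point `(ϖx₁, ϖy₁)` exists and `ȳ₁` is a root of `Y² + γ̄Y − ε̄`
(Silverman's proof, PDF p. 348: every point of `E(K) ∖ E₀(K)` reduces to the singular point and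
lands on one of the two non-identity components). [cite: SilvermanATAEC1994, IV.9.4 Step 5 (PDF p. 344; proof pp. 348–349)] -/
theorem exists_root_of_index_ne_one_IV (J : WeierstrassCurve R) (h1 : J.a₁ ∈ maximalIdeal R)
    (h2 : J.a₂ ∈ maximalIdeal R) {ϖ γ ε : R} (hϖ : Irreducible ϖ) (hγ : J.a₃ = ϖ * γ)
    (h4 : J.a₄ ∈ maximalIdeal R ^ 2) (hε : J.a₆ = ϖ ^ 2 * ε)
    (hidx : (J.nonsingularReductionSubgroup (integers_valuationRing_valuation R K)).index ≠ 1) :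
    ∃ r : ResidueField R, r ^ 2 + residue R γ * r - residue R ε = 0 := by
  -- a point outside `E₀(K)`
  have hex : ∃ P : (J.baseChange K).toAffine.Point, ¬ J.HasNonsingularReduction P := by
    by_contra hall
    push Not at hall
    apply hidx
    rw [AddSubgroup.index_eq_one, eq_top_iff]
    exact fun P _ => (WeierstrassCurve.mem_nonsingularReductionSubgroup_iff _).mpr (hall P)
  obtain ⟨P, hP⟩ := hex
  obtain ⟨α, hα⟩ := (mem_maximalIdeal_iff_dvd_of_irreducible hϖ _).mp h1
  obtain ⟨β, hβ⟩ := (mem_maximalIdeal_iff_dvd_of_irreducible hϖ _).mp h2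
  have h4' : ϖ ^ 2 ∣ J.a₄ := by
    rw [hϖ.maximalIdeal_eq, Ideal.span_singleton_pow, Ideal.mem_span_singleton] at h4
    exact h4
  obtain ⟨δ, hδ⟩ := h4'
  obtain ⟨x₁, y₁, h, -, hid⟩ :=
    exists_eq_some_of_not_hasNonsingularReduction_IV J hϖ hα hβ hγ hδ hε hP
  refine ⟨residue R y₁, ?_⟩
  have := congrArg (residue R) hid
  simpa [residue_uniformizer_eq_zero hϖ] using this

/-- **Silverman, *ATAEC* IV.9.4 Step 5, exact form (Henselian `R`): `c = 3` iff `k' = k`.** For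
an equation `J` over a Henselian discrete valuation ring in the type-`IV` normal form (`a₁, a₂ ∈ 𝔪`,
`a₃ = ϖγ`, `a₄ ∈ 𝔪²`, `a₆ = ϖ²ε`, `γ̄² + 4ε̄ ≠ 0`, `Δ ≠ 0`), the index `[E(K) : E₀(K)]` equals `3`
if and only if the Step-5 quadratic `Y² + γ̄Y − ε̄` has a root in the residue field `k` (i.e.
splits over `k`, being separable of degree `2`). [cite: SilvermanATAEC1994, IV.9.4 Step 5 (PDF p. 344; proof pp. 348–349, Fig. 4.4)] -/
theorem index_eq_three_iff_exists_root_of_normalForm_IV [HenselianLocalRing R]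
    (J : WeierstrassCurve R) (h1 : J.a₁ ∈ maximalIdeal R) (h2 : J.a₂ ∈ maximalIdeal R)
    {ϖ γ ε : R} (hϖ : Irreducible ϖ) (hγ : J.a₃ = ϖ * γ) (h4 : J.a₄ ∈ maximalIdeal R ^ 2)
    (hε : J.a₆ = ϖ ^ 2 * ε) (hdisc : residue R γ ^ 2 + 4 * residue R ε ≠ 0) (hΔ : J.Δ ≠ 0) :
    (J.nonsingularReductionSubgroup (integers_valuationRing_valuation R K)).index = 3 ↔
      ∃ r : ResidueField R, r ^ 2 + residue R γ * r - residue R ε = 0 := by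
  constructor
  · intro h3
    exact exists_root_of_index_ne_one_IV J h1 h2 hϖ hγ h4 hε (by rw [h3]; norm_num)
  · rintro ⟨r, hr⟩
    have hm : ϖ ∈ maximalIdeal R := (IsLocalRing.mem_maximalIdeal _).mpr hϖ.not_isUnit
    have h3 : J.a₃ ∈ maximalIdeal R := hγ ▸ Ideal.mul_mem_right _ _ hm
    have h6 : J.a₆ ∈ maximalIdeal R ^ 2 := hε ▸ Ideal.mul_mem_right _ _ (Ideal.pow_mem_pow hm 2)
    have hb₆ := b₆_not_mem_pow_three_of_disc_ne_zero J hϖ hγ hε hdisc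
    obtain ⟨y₁, h, -, hbad⟩ := exists_not_hasNonsingularReduction_of_root_IV (K := K) J hϖ hγ
      (Ideal.pow_le_self two_ne_zero h4) hε hdisc hΔ hr
    rcases index_mem_of_normalForm_IV (K := K) J h1 h2 h3 h4 h6 hb₆ with hone | hthree
    · exfalso
      apply hbad
      have htop : J.nonsingularReductionSubgroup (integers_valuationRing_valuation R K) = ⊤ := by
        rwa [AddSubgroup.index_eq_one] at hone
      exact (WeierstrassCurve.mem_nonsingularReductionSubgroup_iff _).mp (htop ▸ AddSubgroup.mem_top _)
    · exact hthree

/-- **`c = 1` iff `k' ≠ k`** (Henselian `R`, type-`IV` normal form): the index is `1` iff the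
Step-5 quadratic `Y² + γ̄Y − ε̄` has NO root in `k`. [cite: SilvermanATAEC1994, IV.9.4 Step 5 (PDF p. 344)] -/
theorem index_eq_one_iff_forall_not_root_of_normalForm_IV [HenselianLocalRing R]
    (J : WeierstrassCurve R) (h1 : J.a₁ ∈ maximalIdeal R) (h2 : J.a₂ ∈ maximalIdeal R)
    {ϖ γ ε : R} (hϖ : Irreducible ϖ) (hγ : J.a₃ = ϖ * γ) (h4 : J.a₄ ∈ maximalIdeal R ^ 2)
    (hε : J.a₆ = ϖ ^ 2 * ε) (hdisc : residue R γ ^ 2 + 4 * residue R ε ≠ 0) (hΔ : J.Δ ≠ 0) :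
    (J.nonsingularReductionSubgroup (integers_valuationRing_valuation R K)).index = 1 ↔
      ∀ r : ResidueField R, r ^ 2 + residue R γ * r - residue R ε ≠ 0 := by
  constructor
  · intro hone r hr
    have h3 := (index_eq_three_iff_exists_root_of_normalForm_IV (K := K) J h1 h2 hϖ hγ h4 hε
      hdisc hΔ).mpr ⟨r, hr⟩
    omega
  · intro hno
    by_contra hne
    obtain ⟨r, hr⟩ := exists_root_of_index_ne_one_IV (K := K) J h1 h2 hϖ hγ h4 hε hne
    exact hno r hr

/-- **`c = 1` if the Step-5 quadratic has no root in `k`** — the Hensel-free half, valid over ANY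
discrete valuation ring (type-`IV` normal form; `b₆ ∉ 𝔪³` replaces `γ̄² + 4ε̄ ≠ 0`).
[cite: SilvermanATAEC1994, IV.9.4 Step 5 (PDF p. 344)] -/
theorem index_eq_one_of_forall_not_root_of_normalForm_IV (J : WeierstrassCurve R)
    (h1 : J.a₁ ∈ maximalIdeal R) (h2 : J.a₂ ∈ maximalIdeal R) {ϖ γ ε : R} (hϖ : Irreducible ϖ)
    (hγ : J.a₃ = ϖ * γ) (h4 : J.a₄ ∈ maximalIdeal R ^ 2) (hε : J.a₆ = ϖ ^ 2 * ε)
    (hno : ∀ r : ResidueField R, r ^ 2 + residue R γ * r - residue R ε ≠ 0) :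
    (J.nonsingularReductionSubgroup (integers_valuationRing_valuation R K)).index = 1 := by
  by_contra hne
  obtain ⟨r, hr⟩ := exists_root_of_index_ne_one_IV (K := K) J h1 h2 hϖ hγ h4 hε hne
  exact hno r hr

/-! ### The local Tamagawa number of an elliptic curve with a type-`IV` normal form -/

/-- **`c(W/K) = [J(K) : J₀(K)]` for ANY minimal `R`-model `J` of `W`**: if `D • W = J_K` with
`J_K` minimal, the local Tamagawa number of `W` (computed in the tree on the chosen minimal model
`W.minimal R`) is the index of the points of `J` with nonsingular reduction (Silverman, *AEC*
VII.1.3(b): two minimal equations differ by an `R`-integral change of variables; VII.2.1).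
[cite: SilvermanAEC2009, VII.1 Prop. 1.3(b) and VII.6 Ex. 7.6] -/
theorem localTamagawaNumber_eq_index_of_smul_eq_baseChange (W : WeierstrassCurve K)
    [W.IsElliptic] (J : WeierstrassCurve R) (D : WeierstrassCurve.VariableChange K)
    (hJ : D • W = J.baseChange K) [(J.baseChange K).IsMinimal R] :
    W.localTamagawaNumber R =
      (J.nonsingularReductionSubgroup (integers_valuationRing_valuation R K)).index := by
  rw [← WeierstrassCurve.localTamagawaNumber_variableChange_holds R W D, hJ,
    WeierstrassCurve.localTamagawaNumber, ← WeierstrassCurve.goodReductionSubgroup_baseChange_eq]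
  have hΔ : (J.baseChange K).Δ ≠ 0 := by
    rw [← hJ, WeierstrassCurve.variableChange_Δ]
    exact mul_ne_zero (pow_ne_zero _ (Units.ne_zero _)) (W.coe_Δ' ▸ W.Δ'.ne_zero)
  exact WeierstrassCurve.index_goodReductionSubgroup_eq_of_eq_smul R
    (W₁ := J.baseChange K) (D := ((J.baseChange K).exists_isMinimal R).choose) rfl hΔ

/-- **Silverman, *ATAEC* IV.9.4 Step 5, exact value of the local Tamagawa number (Henselian
`R`).** Let `W` be an elliptic curve over the fraction field `K` of a Henselian discrete
valuation ring `R` and `J` a minimal `R`-model of `W` (`D • W = J_K`) in the type-`IV` normal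
form (`a₁, a₂ ∈ 𝔪`, `a₃ = ϖγ`, `a₄ ∈ 𝔪²`, `a₆ = ϖ²ε`, `γ̄² + 4ε̄ ≠ 0`). Then
`c(W/K) = 3` iff `Y² + γ̄Y − ε̄` has a root in `k` ("`c = 3` if `k' = k`").
[cite: SilvermanATAEC1994, IV.9.4 Step 5 (PDF p. 344; proof pp. 348–349) with Rem. IV.9.3 (PDF p. 341)] -/
theorem localTamagawaNumber_eq_three_iff_exists_root_of_normalForm_IV [HenselianLocalRing R]
    (W : WeierstrassCurve K) [W.IsElliptic] (J : WeierstrassCurve R)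
    (D : WeierstrassCurve.VariableChange K) (hJ : D • W = J.baseChange K)
    [(J.baseChange K).IsMinimal R] (h1 : J.a₁ ∈ maximalIdeal R) (h2 : J.a₂ ∈ maximalIdeal R)
    {ϖ γ ε : R} (hϖ : Irreducible ϖ) (hγ : J.a₃ = ϖ * γ) (h4 : J.a₄ ∈ maximalIdeal R ^ 2)
    (hε : J.a₆ = ϖ ^ 2 * ε) (hdisc : residue R γ ^ 2 + 4 * residue R ε ≠ 0) :
    W.localTamagawaNumber R = 3 ↔ ∃ r : ResidueField R, r ^ 2 + residue R γ * r - residue R ε = 0 := by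
  have hΔ : J.Δ ≠ 0 := by
    intro h0
    have : (J.baseChange K).Δ = 0 := by
      simp only [WeierstrassCurve.baseChange, WeierstrassCurve.map_Δ, h0, map_zero]
    rw [← hJ, WeierstrassCurve.variableChange_Δ] at this
    exact mul_ne_zero (pow_ne_zero _ (Units.ne_zero _)) (W.coe_Δ' ▸ W.Δ'.ne_zero) this
  rw [localTamagawaNumber_eq_index_of_smul_eq_baseChange W J D hJ]
  exact index_eq_three_iff_exists_root_of_normalForm_IV J h1 h2 hϖ hγ h4 hε hdisc hΔ

/-- **Exact value, the other alternative: `c(W/K) = 1` iff `k' ≠ k`** (Henselian `R`, minimal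
`R`-model in the type-`IV` normal form). [cite: SilvermanATAEC1994, IV.9.4 Step 5 (PDF p. 344) with Rem. IV.9.3 (PDF p. 341)] -/
theorem localTamagawaNumber_eq_one_iff_forall_not_root_of_normalForm_IV [HenselianLocalRing R]
    (W : WeierstrassCurve K) [W.IsElliptic] (J : WeierstrassCurve R)
    (D : WeierstrassCurve.VariableChange K) (hJ : D • W = J.baseChange K)
    [(J.baseChange K).IsMinimal R] (h1 : J.a₁ ∈ maximalIdeal R) (h2 : J.a₂ ∈ maximalIdeal R)
    {ϖ γ ε : R} (hϖ : Irreducible ϖ) (hγ : J.a₃ = ϖ * γ) (h4 : J.a₄ ∈ maximalIdeal R ^ 2)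
    (hε : J.a₆ = ϖ ^ 2 * ε) (hdisc : residue R γ ^ 2 + 4 * residue R ε ≠ 0) :
    W.localTamagawaNumber R = 1 ↔ ∀ r : ResidueField R, r ^ 2 + residue R γ * r - residue R ε ≠ 0 := by
  have hΔ : J.Δ ≠ 0 := by
    intro h0
    have : (J.baseChange K).Δ = 0 := by
      simp only [WeierstrassCurve.baseChange, WeierstrassCurve.map_Δ, h0, map_zero]
    rw [← hJ, WeierstrassCurve.variableChange_Δ] at this
    exact mul_ne_zero (pow_ne_zero _ (Units.ne_zero _)) (W.coe_Δ' ▸ W.Δ'.ne_zero) this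
  rw [localTamagawaNumber_eq_index_of_smul_eq_baseChange W J D hJ]
  exact index_eq_one_iff_forall_not_root_of_normalForm_IV J h1 h2 hϖ hγ h4 hε hdisc hΔ

end LocalIndex

end Literature.NumberTheory.EllipticCurves

end
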